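import Summits.BirchSwinnertonDyer.BirchSwinnertonDyer.Theorems.KolyvaginDepthDoorDepthTableRowKit
import Literature.NumberTheory.EllipticCurves.BSDSelmerPConverseRamifiedProofs
import Literature.NumberTheory.EllipticCurves.BSDSelmerPConverseSerreProofs
import HarnessLib
import Literature.NumberTheory.EllipticCurves.HeegnerPointsKolyvaginStructure

/-!
# Route `KolyvaginDepthDoor` — the depth-table ROW KIT AT ANY ODD PRIME `p ∈ B(E)` (Kolyvagin's
# printed hypothesis: `ρ_{E,p^∞}` onto), for the route's `p = 3` CALIBRATION rows
# (crux `KolyvaginDepthSupply`, stmt-BirchSwinnertonDyer-21765)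

Helper file (`--supports stmt-BirchSwinnertonDyer-21765 --as helper`); it closes nothing and BSD is
not proved by it. HONEST FRAMING: the crux asks for `p ≥ 5`; rows at `p = 3` CALIBRATE the route's
instrument (route header: "Known data point: JLS Prop. 3.10 (389a1, p = 3, ℓ = 5, D = 7): κ_{5,1} ≠ 0
at depth 1 = rank − 1 — consistent (p = 3 is below the crux's p ≥ 5, so it calibrates, not
instantiates)"), they do not instantiate the crux.

WHY A SECOND KIT. Every row certificate of the companions (`…KolyvaginDepthSupplyDoor`,
`…DepthTableRowKit`, `…DepthTableRows*`) is conditional on the tree's transcription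
`Kolyvagin1991_selmerCorank_of_kolyvaginClass_ne_zero` of Kolyvagin's structure theorem, which is W.
Zhang's RESTATEMENT at `p ≥ 5` with `ρ̄_{E,p}` onto (Camb. J. Math. 2 (2014), Thm. 11.2 (i)). The
PRINTED theorem (V. A. Kolyvagin, Math. Ann. 291 (1991), §2 Thm. 4 = Thm. 2.3 of the typescript; §1 for the setting) is stated for
every prime `ℓ ∈ B(E)` — ODD primes not dividing `disc End(E)` with `G_ℚ → Aut_{End E}(T_ℓ E)`
SURJECTIVE, i.e. for non-CM `E`: `ℓ` odd with `ρ_{E,ℓ^∞}` onto `GL₂(ℤ_ℓ)` — and so covers `p = 3`,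
the prime of the only depth-table entries that exist in print (Jetchev–Lauter–Stein 2009, Prop. 3.10,
Rem. 3.11: `389a1`, `709a1`, `718b1` at `(p, d_K, ℓ) = (3, −7, 5)`). This file

* states the printed form as ONE cited fact written inline for gate relocation,
  `Kolyvagin1991_selmerCorank_of_kolyvaginClass_ne_zero_of_padicSurj` (same conclusion and same
  data as the tree's fact; hypotheses `p ≠ 2` and `ρ̄_{E,p^m}` onto for every `m` —
  `∀ m, W.HasSurjectiveModNGaloisRep (p ^ m)`, the tree's spelling of `p`-ADIC surjectivity, as in
  `McCallum1991_card_sha_primary_of_derivedPoint_not_divisible` — in place of `5 ≤ p` and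
  `ρ̄_{E,p}` onto), and PROVES that it implies the tree's `p ≥ 5` fact
  (`kolyvagin1991_of_padicSurj`, by Serre's lifting lemma `serre_hasSurjectiveModNGaloisRep_pow_holds`,
  a tree theorem) — so nothing is assumed twice: the old fact is a corollary of the new one;
* re-derives the DOOR at an odd `p ∈ B(E)`: the minimiser bookkeeping
  (`exists_minimal_kolyvaginClass_ne_zero_padic`), the door
  (`shaCorank_eq_zero_of_kolyvaginClass_ne_zero_of_depth_lt_rank_padic`: `c_M(n) ≠ 0` with
  `ν(n) + 1 ≤ rank E(ℚ)` ⇒ `corank_{ℤ_p} Ш(E)[p^∞] = 0`, `c = rank = ν(n) + 1`, `c' ≤ rank − 1` with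
  even defect) and the rank-2 row certificate from a certified lower bound `2 ≤ rank`
  (`depthRow_certificate_of_two_le_rank_padic`: `t_p = 0 ∧ rank = 2 ∧ c = 2 ∧ c' = 1`) — the
  proofs are those of the companions with `hF` replaced by the printed form `hK`;
* supplies the `p`-ADIC IMAGE CERTIFICATE from an integer model
  (`hasSurjectiveModNGaloisRep_pow_of_intModel_certificate`): `gcd(c₄, Δ) = 1` (semistable), a good
  prime `q ≠ p` whose Frobenius polynomial has no root mod `p` (Mazur 6.3 ⇒ `E[p]` irreducible;
  Serre 1972 Prop. 21 ⇒ `ρ̄_{E,p}` onto, tree theorem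
  `hasSurjectiveModNGaloisRep_of_hasIrreducibleModPGaloisRep_of_isSemistable`), and a multiplicative
  prime `ℓ₀ ≠ p` with `ℓ₀ᵉ ∥ Δ`, `p ∤ e` (a transvection in the image of inertia; tree theorem
  `hasSurjectiveModNGaloisRep_pow_of_hasMultiplicativeReductionAtPrime`, ALL `p` — at `p = 3` this
  replaces the mod-`9` check that Serre's `p ≥ 5` lemma cannot give);
* assembles the ROW at an odd prime (`depthRow_of_intModel_certificate_padic`): every side
  condition read off the integer model exactly as in `…DepthTableRowKit`, plus the tower
  certificate, ⇒ `t_p = 0 ∧ rank = 2 ∧ c = 2 ∧ c' = 1` modulo `hK` and the computed bit `c_1(ℓ) ≠ 0`.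

Notation as in the companions: `c = corank_{ℤ_p} Sel_{p^∞}(E/ℚ)`, `c'` the same for the twist
`E^{(d_K)}`, `t_p = corank_{ℤ_p} Ш(E/ℚ)[p^∞] = c − rank` (Kummer identity
`selmerCorank_eq_mordellWeilRank_add_holds`, Greenberg LNM 1716 §1, PROVED in the tree).

References: [Kolyvagin1991MathAnn] V. A. Kolyvagin, *On the structure of Selmer groups*, Math.
Ann. 291 (1991) 253–259, §1 (B(E), the classes `τ_{λ,n}`), §2 Thm. 4 (= typescript Thm. 2.3); [WZhang2014] Thm. 11.2 (i);
[McCallumLMS1991] §1, §3 (the image hypothesis); [JetchevLauterStein2009] J. Number Theory 129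
(2009) = arXiv:0707.0032, §3 (standing hypothesis `p ∤ ND`, `ρ̄_{E,p}` onto), Prop. 3.10, Rem. 3.11;
[Serre1972] §5.4 Prop. 21; [SerreAbelianLadic1968] IV §3.4; [Mazur1978] Prop. 6.3 (1);
[GreenbergLNM1716] §1.
-/

-- D-0017: single-problem summit, `Summit.BirchSwinnertonDyer.BirchSwinnertonDyer.…` repeats a
-- namespace component by design.
set_option linter.dupNamespace false

noncomputable section

open scoped Classical NumberField

/-! ### The cited fact (inline; the gate relocates it next to its `p ≥ 5` sibling) -/

namespace Literature.NumberTheory.EllipticCurves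

open Literature.NumberTheory.EllipticCurves.ModularForms WeierstrassCurve

end Literature.NumberTheory.EllipticCurves

namespace Summit.BirchSwinnertonDyer.BirchSwinnertonDyer.Theorems.KolyvaginDepthDoor

open Literature.NumberTheory.EllipticCurves Literature.NumberTheory.EllipticCurves.ModularForms
  WeierstrassCurve
open Summit.BirchSwinnertonDyer.BirchSwinnertonDyer.Rank1Residual

/-! ## §1 The printed form implies the tree's `p ≥ 5` form -/

/-- **Kolyvagin's theorem in its printed `B(E)` form implies the tree's `p ≥ 5` restatement**: for
`p ≥ 5`, `ρ̄_{E,p}` onto gives `ρ̄_{E,p^m}` onto for every `m` (Serre's lifting lemma, tree theorem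
`serre_hasSurjectiveModNGaloisRep_pow_holds`), so `p ∈ B(E)`. Hence nothing is assumed twice: a
consumer of both facts owes only the printed one. [cite: Kolyvagin1991MathAnn, §1 (B(E), p. 254) and §2 Thm. 4 (= typescript Thm. 2.3)]
[cite: SerreAbelianLadic1968, Ch. IV §3.4] -/
theorem kolyvagin1991_of_padicSurj
    (hK : Literature.NumberTheory.EllipticCurves.Kolyvagin1991_selmerCorank_of_kolyvaginClass_ne_zero_of_padicSurj) :
    Kolyvagin1991_selmerCorank_of_kolyvaginClass_ne_zero := by
  intro W _ _ p hp h5 hsurj K _ _ hIQ h3 h4 hpd hpN _ hH Dt β ι n d M hΛ hM hMle hne hmin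
  have hp2 : p ≠ 2 := by omega
  have htower : ∀ m : ℕ, W.HasSurjectiveModNGaloisRep (p ^ m : ℕ) :=
    serre_hasSurjectiveModNGaloisRep_pow_holds W p h5 hsurj
  exact hK W p hp2 htower K hIQ h3 h4 hpd hpN hH Dt β ι n d M hΛ hM hMle hne hmin

/-! ## §2 The door at an odd prime `p ∈ B(E)` -/

/-- **The minimiser and Kolyvagin's dichotomy there, at an odd `p ∈ B(E)`** (twin of
`exists_minimal_kolyvaginClass_ne_zero` with `hF` replaced by the printed form `hK`): from ONE
non-zero class `c_M(n) ≠ 0` of the system attached to `(Dt, β, ι)`, a non-zero class of minimal depth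
`ν₀ ≤ ν(n)` exists (`Nat.find`), and `hK` gives `{c, c'} = {ν₀ + 1, s}` with `s ≤ ν₀`, `ν₀ − s` even.
CONDITIONAL on `hK`. [cite: Kolyvagin1991MathAnn, §2 Thm. 4 (= typescript Thm. 2.3)] -/
theorem exists_minimal_kolyvaginClass_ne_zero_padic
    (hK : Literature.NumberTheory.EllipticCurves.Kolyvagin1991_selmerCorank_of_kolyvaginClass_ne_zero_of_padicSurj)
    (W : WeierstrassCurve ℚ) [W.IsElliptic] [W.IsGloballyMinimal] (p : ℕ) [hp : Fact p.Prime]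
    (hp2 : p ≠ 2) (htower : ∀ m : ℕ, W.HasSurjectiveModNGaloisRep (p ^ m : ℕ))
    (K : Type) [Field K] [NumberField K] (hIQ : IsImaginaryQuadratic K)
    (h3 : NumberField.discr K ≠ -3) (h4 : NumberField.discr K ≠ -4)
    (hpd : ¬ ((p : ℤ) ∣ NumberField.discr K)) (hpN : ¬ (p ∣ W.conductorNorm ℤ))
    [NeZero (W.conductorNorm ℤ)] (hH : SatisfiesHeegnerHypothesis (W.conductorNorm ℤ) K)
    (Dt : ModularParametrizationData W (W.conductorNorm ℤ)) (β : ℤ) (ι : K →+* ℂ) (n : ℕ)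
    (d : KolyvaginHeegnerData Dt β ι n) (M : ℕ)
    (hΛ : KolyvaginDescent.KolSupp (Zhang2014.IsKolyvaginPrime (W.conductorNorm ℤ) W K p) n)
    (hM : 1 ≤ M) (hMle : (M : ℕ∞) ≤ Zhang2014.levelIndex W p n)
    (hne : d.kolyvaginClass hp.out M ≠ 0) :
    ∃ (n₀ : ℕ) (d₀ : KolyvaginHeegnerData Dt β ι n₀) (M₀ : ℕ),
      KolyvaginDescent.KolSupp (Zhang2014.IsKolyvaginPrime (W.conductorNorm ℤ) W K p) n₀ ∧
      1 ≤ M₀ ∧ (M₀ : ℕ∞) ≤ Zhang2014.levelIndex W p n₀ ∧ d₀.kolyvaginClass hp.out M₀ ≠ 0 ∧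
      n₀.primeFactors.card ≤ n.primeFactors.card ∧
      (∀ (n' : ℕ) (d' : KolyvaginHeegnerData Dt β ι n') (M' : ℕ),
        KolyvaginDescent.KolSupp (Zhang2014.IsKolyvaginPrime (W.conductorNorm ℤ) W K p) n' →
        1 ≤ M' → (M' : ℕ∞) ≤ Zhang2014.levelIndex W p n' → d'.kolyvaginClass hp.out M' ≠ 0 →
        n₀.primeFactors.card ≤ n'.primeFactors.card) ∧
      ((W.selmerCorank p = n₀.primeFactors.card + 1 ∧
          (W.quadraticTwist (NumberField.discr K : ℚ)).selmerCorank p ≤ n₀.primeFactors.card ∧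
          Even (n₀.primeFactors.card -
            (W.quadraticTwist (NumberField.discr K : ℚ)).selmerCorank p)) ∨
        ((W.quadraticTwist (NumberField.discr K : ℚ)).selmerCorank p = n₀.primeFactors.card + 1 ∧
          W.selmerCorank p ≤ n₀.primeFactors.card ∧
          Even (n₀.primeFactors.card - W.selmerCorank p))) := by
  -- the order of vanishing: minimise `ν(n')` over the non-zero classes of this system
  have hex : ∃ k, ∃ (n' : ℕ) (d' : KolyvaginHeegnerData Dt β ι n') (M' : ℕ),
      KolyvaginDescent.KolSupp (Zhang2014.IsKolyvaginPrime (W.conductorNorm ℤ) W K p) n' ∧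
        1 ≤ M' ∧ (M' : ℕ∞) ≤ Zhang2014.levelIndex W p n' ∧ d'.kolyvaginClass hp.out M' ≠ 0 ∧
        n'.primeFactors.card = k :=
    ⟨_, n, d, M, hΛ, hM, hMle, hne, rfl⟩
  obtain ⟨n₀, d₀, M₀, hΛ₀, hM₀, hM₀le, hne₀, hcard⟩ := Nat.find_spec hex
  have hmin : ∀ (n' : ℕ) (d' : KolyvaginHeegnerData Dt β ι n') (M' : ℕ),
      KolyvaginDescent.KolSupp (Zhang2014.IsKolyvaginPrime (W.conductorNorm ℤ) W K p) n' →
      1 ≤ M' → (M' : ℕ∞) ≤ Zhang2014.levelIndex W p n' → d'.kolyvaginClass hp.out M' ≠ 0 →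
      n₀.primeFactors.card ≤ n'.primeFactors.card := by
    intro n' d' M' hΛ' hM' hM'le hne'
    rw [hcard]
    exact Nat.find_min' hex ⟨n', d', M', hΛ', hM', hM'le, hne', rfl⟩
  -- Kolyvagin's structure theorem (printed form) at the minimiser
  have hstruct := hK W p hp2 htower K hIQ h3 h4 hpd hpN hH Dt β ι n₀ d₀ M₀ hΛ₀ hM₀ hM₀le hne₀ hmin
  exact ⟨n₀, d₀, M₀, hΛ₀, hM₀, hM₀le, hne₀, hmin n d M hΛ hM hMle hne, hmin, hstruct⟩

/-- **The per-curve DOOR at an odd `p ∈ B(E)` (modulo Kolyvagin 1991 Thm. 4, printed form).**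
`E/ℚ` globally minimal, `p` odd with `ρ̄_{E,p^m}` onto for all `m`, `K` imaginary quadratic with
the Heegner hypothesis for `N_E`, `d_K ∉ {−3, −4}`, `p ∤ d_K N_E`. If some class `c_M(n) ≠ 0`
(square-free product `n` of Kolyvagin primes, `1 ≤ M ≤ M(n)`) has `ν(n) + 1 ≤ rank E(ℚ)`, then
`corank_{ℤ_p} Ш(E/ℚ)[p^∞] = 0`, `corank Sel_{p^∞}(E/ℚ) = rank E(ℚ) = ν(n) + 1`,
`corank Sel_{p^∞}(E^{(d_K)}/ℚ) + 1 ≤ rank E(ℚ)` with even defect: at the minimiser `ν₀ ≤ ν(n)` the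
dichotomy reads `max(c, c') = ν₀ + 1 ≤ rank ≤ c` (Kummer, `selmerCorank_eq_mordellWeilRank_add_holds`),
so `c = ν₀ + 1 = rank`. Twin of `shaCorank_eq_zero_of_kolyvaginClass_ne_zero_of_depth_lt_rank`.
CONDITIONAL on `hK`; per-curve; BSD is not proved by it. [cite: Kolyvagin1991MathAnn, §2 Thm. 4 (= typescript Thm. 2.3)]
[cite: GreenbergLNM1716, §1 pp. 54–57] -/
theorem shaCorank_eq_zero_of_kolyvaginClass_ne_zero_of_depth_lt_rank_padic
    (hK : Literature.NumberTheory.EllipticCurves.Kolyvagin1991_selmerCorank_of_kolyvaginClass_ne_zero_of_padicSurj)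
    (W : WeierstrassCurve ℚ) [W.IsElliptic] [W.IsGloballyMinimal] (p : ℕ) [hp : Fact p.Prime]
    (hp2 : p ≠ 2) (htower : ∀ m : ℕ, W.HasSurjectiveModNGaloisRep (p ^ m : ℕ))
    (K : Type) [Field K] [NumberField K] (hIQ : IsImaginaryQuadratic K)
    (h3 : NumberField.discr K ≠ -3) (h4 : NumberField.discr K ≠ -4)
    (hpd : ¬ ((p : ℤ) ∣ NumberField.discr K)) (hpN : ¬ (p ∣ W.conductorNorm ℤ))
    [NeZero (W.conductorNorm ℤ)] (hH : SatisfiesHeegnerHypothesis (W.conductorNorm ℤ) K)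
    (Dt : ModularParametrizationData W (W.conductorNorm ℤ)) (β : ℤ) (ι : K →+* ℂ) (n : ℕ)
    (d : KolyvaginHeegnerData Dt β ι n) (M : ℕ)
    (hΛ : KolyvaginDescent.KolSupp (Zhang2014.IsKolyvaginPrime (W.conductorNorm ℤ) W K p) n)
    (hM : 1 ≤ M) (hMle : (M : ℕ∞) ≤ Zhang2014.levelIndex W p n)
    (hne : d.kolyvaginClass hp.out M ≠ 0)
    (hdepth : n.primeFactors.card + 1 ≤ W.mordellWeilRank) :
    W.shaCorank p = 0 ∧ W.selmerCorank p = W.mordellWeilRank ∧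
      n.primeFactors.card + 1 = W.mordellWeilRank ∧
      (W.quadraticTwist (NumberField.discr K : ℚ)).selmerCorank p + 1 ≤ W.mordellWeilRank ∧
      Even (W.mordellWeilRank - 1 - (W.quadraticTwist (NumberField.discr K : ℚ)).selmerCorank p) := by
  obtain ⟨n₀, d₀, M₀, -, -, -, -, hle, -, hstruct⟩ :=
    exists_minimal_kolyvaginClass_ne_zero_padic hK W p hp2 htower K hIQ h3 h4 hpd hpN hH Dt β ι n d
      M hΛ hM hMle hne
  -- Kummer: `c = r + t_p ≥ r`
  have hid : W.selmerCorank p = W.mordellWeilRank + W.shaCorank p :=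
    W.selmerCorank_eq_mordellWeilRank_add_holds p
  rcases hstruct with ⟨hc, hc', hev⟩ | ⟨-, hc, -⟩
  · refine ⟨by omega, by omega, by omega, by omega, ?_⟩
    have h0 : n₀.primeFactors.card = W.mordellWeilRank - 1 := by omega
    rw [← h0]
    exact hev
  · exfalso
    omega

/-- **Rank-2 ROW CERTIFICATE at an odd `p ∈ B(E)` from a certified lower bound `2 ≤ rank_ℤ E(ℚ)`
(modulo Kolyvagin 1991 Thm. 4, printed form)** — twin of `depthRow_certificate_of_two_le_rank`:
ONE Kolyvagin prime `ℓ`, a datum of conductor `ℓ`, `1 ≤ M ≤ M(ℓ)` and `c_M(ℓ) ≠ 0` give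
`corank_{ℤ_p} Ш(E/ℚ)[p^∞] = 0`, `rank_ℤ E(ℚ) = 2` EXACTLY (upper bound from Kolyvagin),
`corank Sel_{p^∞}(E/ℚ) = 2`, `corank Sel_{p^∞}(E^{(d_K)}/ℚ) = 1` (parity clause). CONDITIONAL on
`hK` and on the computed bit; per-curve; BSD is not proved by it.
[cite: Kolyvagin1991MathAnn, §2 Thm. 4 (= typescript Thm. 2.3)] [cite: JetchevLauterStein2009, §3.6 (arXiv:0707.0032)] -/
theorem depthRow_certificate_of_two_le_rank_padic
    (hK : Literature.NumberTheory.EllipticCurves.Kolyvagin1991_selmerCorank_of_kolyvaginClass_ne_zero_of_padicSurj)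
    (W : WeierstrassCurve ℚ) [W.IsElliptic] [W.IsGloballyMinimal] (hr : 2 ≤ W.mordellWeilRank)
    (p : ℕ) [hp : Fact p.Prime] (hp2 : p ≠ 2)
    (htower : ∀ m : ℕ, W.HasSurjectiveModNGaloisRep (p ^ m : ℕ))
    (K : Type) [Field K] [NumberField K] (hIQ : IsImaginaryQuadratic K)
    (h3 : NumberField.discr K ≠ -3) (h4 : NumberField.discr K ≠ -4)
    (hpd : ¬ ((p : ℤ) ∣ NumberField.discr K)) (hpN : ¬ (p ∣ W.conductorNorm ℤ))
    [NeZero (W.conductorNorm ℤ)] (hH : SatisfiesHeegnerHypothesis (W.conductorNorm ℤ) K)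
    (Dt : ModularParametrizationData W (W.conductorNorm ℤ)) (β : ℤ) (ι : K →+* ℂ)
    (ℓ : ℕ) (hℓ : ℓ.Prime) (hkol : Zhang2014.IsKolyvaginPrime (W.conductorNorm ℤ) W K p ℓ)
    (d : KolyvaginHeegnerData Dt β ι ℓ) (M : ℕ)
    (hM : 1 ≤ M) (hMle : (M : ℕ∞) ≤ Zhang2014.levelIndex W p ℓ)
    (hne : d.kolyvaginClass hp.out M ≠ 0) :
    W.shaCorank p = 0 ∧ W.mordellWeilRank = 2 ∧ W.selmerCorank p = 2 ∧
      (W.quadraticTwist (NumberField.discr K : ℚ)).selmerCorank p = 1 := by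
  have hΛ : KolyvaginDescent.KolSupp (Zhang2014.IsKolyvaginPrime (W.conductorNorm ℤ) W K p) ℓ :=
    KolyvaginDescent.kolSupp_prime hℓ hkol
  have hcard : ℓ.primeFactors.card = 1 := by
    rw [hℓ.primeFactors, Finset.card_singleton]
  obtain ⟨ht, hc, hν, hc', hev⟩ :=
    shaCorank_eq_zero_of_kolyvaginClass_ne_zero_of_depth_lt_rank_padic hK W p hp2 htower K hIQ h3 h4
      hpd hpN hH Dt β ι ℓ d M hΛ hM hMle hne (by omega)
  have hr2 : W.mordellWeilRank = 2 := by omega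
  refine ⟨ht, hr2, by omega, ?_⟩
  rw [hr2] at hc' hev
  have h2 := Nat.even_iff.mp hev
  omega

/-! ## §3 Certificates read off an integer model: the `p`-adic image and the assembled row -/

section Generic

variable {W : WeierstrassCurve ℚ} [W.IsElliptic] [W.IsGloballyMinimal] {E₀ : WeierstrassCurve ℤ}
  (hI : integralModelInt W = E₀)
include hI

/-- **`ρ̄_{E,p^m}` ONTO FOR EVERY `m` (i.e. `p ∈ B(E)` for odd `p`) from the integer model**, all
primes `p`: `gcd(c₄(E₀), Δ(E₀)) = 1` (semistable), a good prime `q ∤ Δ(E₀)`, `q ≠ p`, with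
`#(E₀ mod q)(𝔽_q) = n` and `X² − (q + 1 − n)X + q` root-free mod `p` (Mazur 6.3 ⇒ `E[p]`
irreducible; Serre 1972 Prop. 21 for semistable curves ⇒ `ρ̄_{E,p}` onto — tree theorem
`hasSurjectiveModNGaloisRep_of_intModel_certificate`), and a prime `ℓ₀ ≠ p` with `ℓ₀ ∣ Δ(E₀)`,
`ℓ₀ ∤ c₄(E₀)` (multiplicative), `ℓ₀ᵉ ∥ Δ(E₀)`, `p ∤ e` (`ρ̄_{E,p}` ramified at `ℓ₀`: the inertia at
`ℓ₀` puts a transvection in the image, and a subgroup of `GL₂(ℤ/p^m)` onto `GL₂(𝔽_p)` with full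
determinant containing a transvection is everything — tree theorem
`hasSurjectiveModNGaloisRep_pow_of_hasMultiplicativeReductionAtPrime`, which at `p = 3` replaces the
mod-`9` verification). Unconditional. [cite: Serre1972, §5.4 Prop. 21]
[cite: Mazur1978, §6 Prop. 6.3 (1)] [cite: SerreAbelianLadic1968, Ch. IV §3.4] -/
theorem hasSurjectiveModNGaloisRep_pow_of_intModel_certificate (hcop : IsCoprime E₀.c₄ E₀.Δ)
    (p q : ℕ) [Fact p.Prime] [Fact q.Prime] (hqp : q ≠ p) (hqΔ : ¬ (q : ℤ) ∣ E₀.Δ) {n : ℕ}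
    (hcard : Nat.card ((E₀.map (Int.castRingHom (ZMod q))).toAffine.Point) = n)
    (hnoroot : ∀ t : ZMod p, t ^ 2 - (((q : ℤ) + 1 - n : ℤ) : ZMod p) * t + (q : ZMod p) ≠ 0)
    (ℓ₀ : ℕ) (hℓ₀ : ℓ₀.Prime) (hℓ₀p : ℓ₀ ≠ p) (hℓ₀Δ : (ℓ₀ : ℤ) ∣ E₀.Δ) (hℓ₀c₄ : ¬ (ℓ₀ : ℤ) ∣ E₀.c₄)
    {e : ℕ} (he : (ℓ₀ : ℤ) ^ e ∣ E₀.Δ) (he' : ¬ (ℓ₀ : ℤ) ^ (e + 1) ∣ E₀.Δ) (hpe : ¬ p ∣ e)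
    (m : ℕ) : W.HasSurjectiveModNGaloisRep (p ^ m : ℕ) :=
  hasSurjectiveModNGaloisRep_pow_of_hasMultiplicativeReductionAtPrime W p
    (hasSurjectiveModNGaloisRep_of_intModel_certificate hI hcop p q hqp hqΔ hcard hnoroot)
    (IntModel.ram_of_intModel hI p ℓ₀ hℓ₀ hℓ₀p hℓ₀Δ hℓ₀c₄ he he' hpe) m

/-- **The depth-table ROW AT AN ODD PRIME with concrete admissible data (modulo Kolyvagin 1991
Thm. 4 in its printed form = `hK`)** — twin of `depthRow_of_intModel_certificate` with the image
hypothesis in Kolyvagin's printed form. Inputs: a globally minimal elliptic `W/ℚ` with integral model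
`E₀` and a certified lower bound `2 ≤ rank_ℤ E(ℚ)`; an odd prime `p ∤ Δ(E₀)` with `ρ̄_{E,p^m}` onto
for all `m` (e.g. `hasSurjectiveModNGaloisRep_pow_of_intModel_certificate`); an imaginary quadratic
`K` of discriminant `D ∉ {−3, −4}`, `p ∤ D`, in which every prime of `Δ(E₀)` splits (Heegner
hypothesis for `N_E`); an odd prime `ℓ ∤ Δ(E₀) D`, `ℓ ≠ p`, `(D/ℓ) = −1`, `p ∣ ℓ + 1`,
`p ∣ a_ℓ = ℓ + 1 − #(E₀ mod ℓ)(𝔽_ℓ)` (a Kolyvagin prime with `M(ℓ) ≥ 1`); a parametrisation datum of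
level `N_E` and a Kolyvagin–Heegner datum `d` of conductor `ℓ`. OUTPUT: if `c_1(ℓ) ≠ 0` then
`corank_{ℤ_p} Ш(E)[p^∞] = 0`, `rank_ℤ E(ℚ) = 2`, `corank Sel_{p^∞}(E/ℚ) = 2`,
`corank Sel_{p^∞}(E^{(D)}/ℚ) = 1`. Per-curve; conditional on `hK` and on the computed bit; BSD is not
proved by it. [cite: Kolyvagin1991MathAnn, §2 Thm. 4 (= typescript Thm. 2.3)] [cite: WZhang2014, Notations (xii)]
[cite: JetchevLauterStein2009, §3.6 (arXiv:0707.0032)] -/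
theorem depthRow_of_intModel_certificate_padic
    (hK : Literature.NumberTheory.EllipticCurves.Kolyvagin1991_selmerCorank_of_kolyvaginClass_ne_zero_of_padicSurj)
    (hr : 2 ≤ W.mordellWeilRank)
    (p : ℕ) [hp : Fact p.Prime] (hp2 : p ≠ 2) (hpΔ : ¬ (p : ℤ) ∣ E₀.Δ)
    (htower : ∀ m : ℕ, W.HasSurjectiveModNGaloisRep (p ^ m : ℕ))
    (K : Type) [Field K] [NumberField K] (hIQ : IsImaginaryQuadratic K) {D : ℤ}
    (hD : NumberField.discr K = D) (h3 : D ≠ -3) (h4 : D ≠ -4) (hpD : ¬ (p : ℤ) ∣ D)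
    (hH : ∀ q : ℕ, q.Prime → (q : ℤ) ∣ E₀.Δ → (q = 2 → D % 8 = 1) ∧ (q ≠ 2 → jacobiSym D q = 1))
    (ℓ : ℕ) (hℓ : ℓ.Prime) (hℓ2 : ℓ ≠ 2) (hℓΔ : ¬ (ℓ : ℤ) ∣ E₀.Δ) (hℓD : ¬ (ℓ : ℤ) ∣ D)
    (hℓp : ℓ ≠ p) (hjac : jacobiSym D ℓ = -1) (hℓ1 : p ∣ ℓ + 1) {n : ℕ}
    (hcard : Nat.card ((E₀.map (Int.castRingHom (ZMod ℓ))).toAffine.Point) = n)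
    (haℓ : (p : ℤ) ∣ (ℓ : ℤ) + 1 - n)
    [NeZero (W.conductorNorm ℤ)] (Dt : ModularParametrizationData W (W.conductorNorm ℤ)) (β : ℤ)
    (ι : K →+* ℂ) (d : KolyvaginHeegnerData Dt β ι ℓ) (hne : d.kolyvaginClass hp.out 1 ≠ 0) :
    W.shaCorank p = 0 ∧ W.mordellWeilRank = 2 ∧ W.selmerCorank p = 2 ∧
      (W.quadraticTwist (D : ℚ)).selmerCorank p = 1 := by
  obtain ⟨hkol, hlev⟩ := isKolyvaginPrime_of_intModel_certificate hI p K hIQ.1 hD ℓ hℓ hℓ2 hℓΔ hℓD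
    hℓp hjac hℓ1 hcard haℓ
  have h := depthRow_certificate_of_two_le_rank_padic hK W hr p hp2 htower K hIQ
    (by rw [hD]; exact h3) (by rw [hD]; exact h4) (by rw [hD]; exact hpD)
    (not_dvd_conductorNorm_of_not_dvd_Δ hI hp.out hpΔ)
    (satisfiesHeegnerHypothesis_conductorNorm_of_intModel hI K hIQ.1 hD hH) Dt β ι ℓ hℓ hkol d 1
    le_rfl hlev hne
  rw [hD] at h
  exact h

end Generic

end Summit.BirchSwinnertonDyer.BirchSwinnertonDyer.Theorems.KolyvaginDepthDoor

end
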